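import Literature.NumberTheory.EllipticCurves.PAdicLFunctionMinusMult
import HarnessLib

/-!
# The `ω^i`-branches of the one-term minus Mazur–Tate–Teitelbaum measure at `p ∣ N`, TWISTED by a finite-order
# character `ψ` of `Γ` (`ψ(γ) = ε`): `L⁻_p(f, α, ω^i ψ, T) = ∫ ω^i(x) ψ(⟨x⟩) (1+T)^{ℓ(x)} dμ⁻_{f,α}(x)`

Topic `NumberTheory/EllipticCurves`; namespace `Literature.NumberTheory.EllipticCurves`. DEFINITIONS only (plus two
unfolding lemmas and the reduction `ε = 1`); nothing asserted, no named fact (D-0026). Companion of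
`PAdicLFunctionMinusMult` (`padicLFunctionMinusBranchMult f α i` = the case `ψ = 1`).

**The point.** For an eigenform `f` of level `N`, `p ∥ N`, allowable root `α = a_p` (Mazur–Tate–Teitelbaum 1986, Ch. I §10
with `ε(p) = 0`: the ONE-term measure `μ⁻_{f,α}`, tree `msdMinusMeasureMult`), the `p`-adic `L`-function is the function
`χ ↦ ∫_{ℤ_p^×} χ dμ_{f,α}` on continuous characters of `ℤ_p^× = Δ × Γ` (§I.13). Writing `x = ω(x)·γ^{ℓ(x)}` (`γ =
cyclotomicGenerator p`, `ℓ(x) ∈ ℤ_p`), a character is `ω^i · ψ · (1+T)^{ℓ}` with `ψ` of finite order on `Γ`; the tree's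
`padicLFunctionMinusBranchMult f α i` records the branches `ψ = 1`. This file adds the branches twisted by a finite-order
`ψ`, through the single number `ε = ψ(γ)` (a `p`-power root of unity in `ℚ_p`; at `p = 2` the only non-trivial case in `ℚ₂`
is `ε = −1`, `ψ = χ₂` the character of `ℚ(√2) = ℚ₁ ⊂ ℚ_∞`): in the Riemann sums over the classes `ζ γˢ + p^{n+e₀}ℤ_p` the
twist is the factor `εˢ` (well defined on `s mod pⁿ` as soon as `ε^{pⁿ} = 1`, i.e. for `n` large; the limit only sees large
`n`). As a function of `T` this is `T ↦ L⁻(ε(1+T) − 1)`, a substitution that is NOT a formal one (`ε − 1` is not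
nilpotent), whence a definition of its own.

* `padicLMinusBranchMultTwistRiemannSum f α i ε k n = ∑_ζ ζ^i ∑_{s mod pⁿ} εˢ · μ⁻(ζγˢ + p^{n+e₀}ℤ_p) · (s choose k)`;
* `padicLMinusBranchMultTwistCoeff f α i ε k` (its limit, junk if divergent), `padicLFunctionMinusBranchMultTwist f α i ε`
  (the power series); `coeff_…` (unfolding); `padicLFunctionMinusBranchMultTwist_one`: `ε = 1` gives back
  `padicLFunctionMinusBranchMult f α i`.

Motivation (cell `bsd-2adic`, seat `addL2x` GEN 16, crux stmt-BirchSwinnertonDyer-19098, T20 (f)): for `E` additive at `2`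
with `E'' = E^{(−2)}` split multiplicative at `2`, `E = E'' ⊗ χ_{−2} = E'' ⊗ ω χ₂`, so the cyclotomic Iwasawa theory of `E`
over `ℚ_∞` sits in the branch `ω·χ₂` of the two-variable measure of `E''`: `L_E(T) = L⁻_2(f_{E''}, 1, ω χ₂, T) =
padicLFunctionMinusBranchMultTwist f 1 1 (−1)`. The (−1)-block uses `ψ = 1`. HONEST FRAMING: vocabulary only.

## References
* B. Mazur, J. Tate, J. Teitelbaum, *On `p`-adic analogues of the conjectures of Birch and Swinnerton-Dyer*, Invent. Math.
  84 (1986) 1–48: Ch. I §10 (10.1) (`ε(p) = 0` for `p ∣ N`), §13 (the `p`-adic `L`-function as a function on characters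
  of `ℤ_p^×`; branches), §14. [MazurTateTeitelbaum1986Invent]
* R. Greenberg, *Iwasawa theory for elliptic curves*, LNM 1716 (1999), §1 (pp. 67–68: `x = ω(x)⟨x⟩`, `⟨x⟩ = γ^{ℓ(x)}`;
  twists by characters of `Γ`). [GreenbergLNM1716]
-/

noncomputable section

open scoped MatrixGroups ModularForm

open CongruenceSubgroup Filter Topology Literature.NumberTheory.EllipticCurves.ModularForms

namespace Literature.NumberTheory.EllipticCurves

section Measure

variable {N : ℕ} (f : CuspForm (Gamma0 N) 2) {p : ℕ} [Fact p.Prime]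

/-- The `n`-th **Riemann sum** for the `k`-th coefficient of the `ω^i ψ`-branch of the one-term minus measure at
`p ∣ N`, `ψ` the character of `Γ` with `ψ(γ) = ε`: `∑_ζ ζ^i ∑_{s mod pⁿ} εˢ · μ⁻_{f,α}(ζ γˢ + p^{n+e₀}ℤ_p) · (s choose k)`
(`ζ` over the Teichmüller representatives, `γ = cyclotomicGenerator p`, `e₀ = cyclotomicExponent p`, `s` represented by
`s.val ∈ [0, pⁿ)`) — `padicLMinusBranchMultRiemannSum` with the extra factor `ε^{s.val}`.
[cite: MazurTateTeitelbaum1986Invent, §I.13] -/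
def padicLMinusBranchMultTwistRiemannSum (α : ℚ_[p]) (i : ℕ) (ε : ℚ_[p]) (k n : ℕ) : ℚ_[p] :=
  ∑ᶠ ζ : rootsOfUnity (torsionOrder p) ℤ_[p], ∑ s : ZMod (p ^ n),
    ((((ζ : ℤ_[p]ˣ) : ℤ_[p]) : ℚ_[p]) ^ i * ε ^ s.val *
      msdMinusMeasureMult f α (n + cyclotomicExponent p)
          (PadicInt.toZModPow (n + cyclotomicExponent p) ((ζ : ℤ_[p]ˣ) : ℤ_[p]) *
            (cyclotomicGenerator p : ZMod (p ^ (n + cyclotomicExponent p))) ^ s.val) *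
        (s.val.choose k : ℚ_[p]))

/-- The `k`-th **coefficient of the `ω^i ψ`-branch** (`ψ(γ) = ε`) of the one-term minus measure at `p ∣ N`:
`∫_{ℤ_p^×} ω^i(x) ψ(⟨x⟩) (ℓ(x) choose k) dμ⁻_{f,α}(x) = lim_n padicLMinusBranchMultTwistRiemannSum f α i ε k n` (junk value of
`limUnder` if the limit does not exist). [cite: MazurTateTeitelbaum1986Invent, §I.11–I.13] -/
def padicLMinusBranchMultTwistCoeff (α : ℚ_[p]) (i : ℕ) (ε : ℚ_[p]) (k : ℕ) : ℚ_[p] :=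
  limUnder atTop (padicLMinusBranchMultTwistRiemannSum f α i ε k)

/-- The **`ω^i ψ`-branch of the `p`-adic `L`-function at a prime `p ∣ N`** (one-term MINUS measure), `ψ` the finite-order
character of `Γ` with `ψ(γ) = ε`: `L⁻_p(f, α, ω^i ψ, T) = ∫_{ℤ_p^×} ω^i(x) ψ(⟨x⟩) (1 + T)^{ℓ(x)} dμ⁻_{f,α}(x) ∈ ℚ_p⟦T⟧`
— as a function of `T`, `L⁻_p(f, α, ω^i, ε(1+T) − 1)`. At `p = 2`, `i = 1`, `ε = −1` (`ψ = χ₂`), `α = a₂ = 1` and `f` the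
newform of a curve `E''` split multiplicative at `2`, this is the branch carrying the cyclotomic Iwasawa theory over `ℚ_∞`
of the ADDITIVE curve `E'' ⊗ χ_{−2}`. [cite: MazurTateTeitelbaum1986Invent, §I.13] -/
def padicLFunctionMinusBranchMultTwist (α : ℚ_[p]) (i : ℕ) (ε : ℚ_[p]) : PowerSeries ℚ_[p] :=
  PowerSeries.mk (padicLMinusBranchMultTwistCoeff f α i ε)

/-- The `k`-th coefficient of `L⁻_p(f, α, ω^i ψ, T)` is `padicLMinusBranchMultTwistCoeff f α i ε k` (unfolding).
[cite: MazurTateTeitelbaum1986Invent, §I.13] -/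
@[simp] theorem coeff_padicLFunctionMinusBranchMultTwist (α : ℚ_[p]) (i : ℕ) (ε : ℚ_[p]) (k : ℕ) :
    PowerSeries.coeff k (padicLFunctionMinusBranchMultTwist f α i ε) = padicLMinusBranchMultTwistCoeff f α i ε k :=
  PowerSeries.coeff_mk _ _

/-- `ε = 1` (trivial `ψ`): the twisted Riemann sums ARE the untwisted ones. [cite: MazurTateTeitelbaum1986Invent, §I.13] -/
theorem padicLMinusBranchMultTwistRiemannSum_one (α : ℚ_[p]) (i k n : ℕ) :
    padicLMinusBranchMultTwistRiemannSum f α i 1 k n = padicLMinusBranchMultRiemannSum f α i k n := by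
  simp only [padicLMinusBranchMultTwistRiemannSum, padicLMinusBranchMultRiemannSum, one_pow, mul_one]

/-- `ε = 1` (trivial `ψ`): `L⁻_p(f, α, ω^i·1, T) = L⁻_p(f, α, ω^i, T)` (`padicLFunctionMinusBranchMult`).
[cite: MazurTateTeitelbaum1986Invent, §I.13] -/
theorem padicLFunctionMinusBranchMultTwist_one (α : ℚ_[p]) (i : ℕ) :
    padicLFunctionMinusBranchMultTwist f α i 1 = padicLFunctionMinusBranchMult f α i := by
  ext k
  rw [coeff_padicLFunctionMinusBranchMultTwist, coeff_padicLFunctionMinusBranchMult,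
    padicLMinusBranchMultTwistCoeff, padicLMinusBranchMultCoeff]
  congr 1
  funext n
  exact padicLMinusBranchMultTwistRiemannSum_one f α i k n

end Measure

end Literature.NumberTheory.EllipticCurves

end
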